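import Summits.KontsevichZagierPeriods.KontsevichZagierPeriods.Theorems.LinRedNormalFormArrangementNormalFormSeparateTwoPosInduction
import Summits.KontsevichZagierPeriods.KontsevichZagierPeriods.Theorems.LinRedNormalFormArrangementNormalFormSeparateDominated

/-!
# The piece theorem with fibres: far-first separation on a good piece in good coordinates

(Line `janus-bands`, crux `ArrangementNormalForm`, stub `stub_separateTwoPos` — separation in a
good rational direction for planar Janus band representations WITH `k` fibres; part `Piece`.)

`SepTwoPos.piece_theorem` (registered as `separateTwoPos_piece`): a planar Janus band
representation with `k` fibres on a GOOD piece of the base (final coordinates: every special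
point `X ∈ 𝒳` has the double cone given by two rows through it, two special points are
separated by a row, crossings of active `y`-letters lie in `𝒳`, letters do not vanish on the
open piece, `y`-free letters are bounded away from zero) is congruent modulo `KZ.relations` to a
`ℤ`-combination of elements of `GG 1 1 k`, GIVEN an abstract terminal theorem `hTerm` for the
terminal shapes of the far-first separation (supplied by `SepTwoPos.terminal` from the
termwise-convergence lemma of the Taylor split). The proof is the fibre-free
`SepTwoZero.piece_theorem` with the fibres riding along: the vertex `V` is the special point
lying under the closed piece (unique by the separators), far pairs have harmless walls
(`SepTwoPos.fst_sub_bounded_below`), near pairs satisfy the ratio condition by the double cone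
(`SepTwoPos.cone_of_rows`), and `SepTwoPos.sepV_induction` runs the engine.
-/

noncomputable section

open Set MeasureTheory Filter Topology

namespace Summit.KontsevichZagierPeriods.ArrangementNormalForm.JanusBands

open Literature.NumberTheory.Transcendental

namespace SepTwoPos

open SeparatePos SepTwoZero MvPolynomial

section PieceThm

variable {k : ℕ}

/-- **Piece theorem with fibres.** A planar Janus band representation with `k` fibres on a GOOD
piece (final coordinates: every special point `X ∈ 𝒳` has the double cone given by two rows
through it, two special points are separated by a row, crossings of active `y`-letters lie in
`𝒳`, letters do not vanish on the open piece, `y`-free letters are bounded away from zero) is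
congruent modulo `KZ.relations` to a `ℤ`-combination of elements of `GG 1 1 k`, given the
terminal theorem `hTerm` for the terminal shapes of the far-first separation
(`sepV_induction`). [Kontsevich–Zagier 2001, §1.2] -/
theorem piece_theorem
    (hTerm : ∀ (m' r : ℕ) (M : Fin m' → (Fin (1 + 1) → ℚ) × ℚ) (p : MvPolynomial (Fin (1 + 1)) ℚ)
      (lam : Fin r → (Fin 1 → ℚ) × ℚ) (a : Fin k → Option ((Fin (1 + 1) → ℚ) × ℚ))
      (lo up : Fin k → Fin k ⊕ ((Fin (1 + 1) → ℚ) × ℚ)) (V : ℚ × ℚ) (m : ℕ)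
      (L : Fin m → (Fin 1 → ℚ) × ℚ) (e : Fin m → ℕ) (d : Fin r → ℕ) (s : KZ.IntegralRep (1 + 1 + k))
      (ℓ : (Fin 1 → ℚ) × ℚ), Bornology.IsBounded s.domain → s.domain = gDom 1 k m' M lo up →
      EqOn s.integrand (shape 1 k p L e lam d a) s.domain →
      (∀ j, d j ≠ 0 → ∀ z ∈ s.domain, z (Fin.castAdd k (Fin.last 1)) - affB 1 k (lam j) z ≠ 0) →
      (∀ j, d j ≠ 0 → lam j = ℓ) →
      (∀ j, e j ≠ 0 → (∃ c₀ > 0, ∀ z ∈ s.domain, c₀ ≤ |affB 1 k (L j) z|) ∨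
        ((L j).1 0 ≠ 0 ∧ (L j).1 0 * V.1 + (L j).2 = 0 ∧ (∃ i, d i ≠ 0) ∧
          (∀ i, d i ≠ 0 → (lam i).1 0 * V.1 + (lam i).2 = V.2) ∧
          ∃ a₁ b₁ : ℚ, ∀ z ∈ s.domain, (a₁ : ℝ) * (z (Fin.castAdd k 0) - V.1) <
            z (Fin.castAdd k 1) - V.2 ∧
            z (Fin.castAdd k 1) - V.2 < (b₁ : ℝ) * (z (Fin.castAdd k 0) - V.1))) →
      ∃ c ∈ AddSubgroup.closure (GGset 1 1 k), KZ.of s - c ∈ KZ.relations)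
    {m m' : ℕ} (s : KZ.IntegralRep (1 + 1 + k))
    (M : Fin m' → (Fin (1 + 1) → ℚ) × ℚ) (L : Fin m → (Fin (1 + 1) → ℚ) × ℚ) (e : Fin m → ℕ)
    (p : MvPolynomial (Fin (1 + 1)) ℚ) (a : Fin k → Option ((Fin (1 + 1) → ℚ) × ℚ))
    (lo up : Fin k → Fin k ⊕ ((Fin (1 + 1) → ℚ) × ℚ))
    (hbd : Bornology.IsBounded s.domain) (hdom : s.domain = gDom 1 k m' M lo up)
    (hint : EqOn s.integrand (fun z => MvPolynomial.aeval (fun i => z (Fin.castAdd k i)) p /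
      (∏ j, affF 1 k (L j) z ^ e j) * fib 1 k a z) s.domain)
    (𝒳 : Finset (ℚ × ℚ))
    (HX : ∀ i i' (X : ℚ × ℚ), e i ≠ 0 → e i' ≠ 0 → (L i).1 1 ≠ 0 → (L i').1 1 ≠ 0 →
      evq (L i) X = 0 → evq (L i') X = 0 → (L i).1 0 * (L i').1 1 ≠ (L i).1 1 * (L i').1 0 → X ∈ 𝒳)
    (Ha : ∀ X ∈ 𝒳, ∃ j j', evq (M j) X = 0 ∧ evq (M j') X = 0 ∧ (M j).1 1 < 0 ∧ 0 < (M j').1 1)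
    (Hb : ∀ X ∈ 𝒳, ∀ X' ∈ 𝒳, X ≠ X' → ∃ j, evq (M j) X * evq (M j) X' < 0)
    (hpole : ∀ i, e i ≠ 0 → ∀ z ∈ s.domain, affF 1 k (L i) z ≠ 0)
    (Hv : ∀ i, e i ≠ 0 → (L i).1 1 = 0 → ∃ c₀ > 0, ∀ z ∈ s.domain, c₀ ≤ |affF 1 k (L i) z|) :
    ∃ c ∈ AddSubgroup.closure (GGset 1 1 k), KZ.of s - c ∈ KZ.relations := by
  classical
  -- the separation shape of the input
  set lam : Fin m → (Fin 1 → ℚ) × ℚ := fun j => root 1 (L j) with hlam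
  set d : Fin m → ℕ := fun j => if (L j).1 (Fin.last 1) = 0 then 0 else e j with hdd
  set Lb : Fin m → (Fin 1 → ℚ) × ℚ := fun j => if (L j).1 (Fin.last 1) = 0 then restr 1 (L j)
    else (0, 1) with hLb
  set eb : Fin m → ℕ := fun j => if (L j).1 (Fin.last 1) = 0 then e j else 0 with heb
  set p' : MvPolynomial (Fin (1 + 1)) ℚ := MvPolynomial.C (∏ j, lead 1 (L j) (e j))⁻¹ * p with hp'
  have hd : ∀ j, d j ≠ 0 → (L j).1 1 ≠ 0 ∧ e j ≠ 0 := fun j hj => by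
    have hdj : d j = if (L j).1 (Fin.last 1) = 0 then 0 else e j := rfl
    by_cases h : (L j).1 (Fin.last 1) = 0
    · rw [hdj, if_pos h] at hj; exact absurd rfl hj
    · rw [hdj, if_neg h] at hj; exact ⟨h, hj⟩
  have hshape : EqOn s.integrand (shape 1 k p' Lb eb lam d a) s.domain := fun z hz => by
    rw [hint hz]; exact jshape_eq L e _ a z
  -- the vertex: the special point lying under the closed piece, if any
  set V : ℚ × ℚ := if h : ∃ X ∈ 𝒳, ∃ z ∈ closure s.domain, z (Fin.castAdd k 0) = X.1 ∧
    z (Fin.castAdd k 1) = X.2 then h.choose else (0, 0) with hV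
  have hVuniq : ∀ X ∈ 𝒳, ∀ z ∈ closure s.domain, z (Fin.castAdd k 0) = X.1 →
      z (Fin.castAdd k 1) = X.2 → X = V := by
    intro X hX z hzcl hzx hzy
    have hex : ∃ X ∈ 𝒳, ∃ z ∈ closure s.domain, z (Fin.castAdd k 0) = X.1 ∧
        z (Fin.castAdd k 1) = X.2 := ⟨X, hX, z, hzcl, hzx, hzy⟩
    have hVs : V ∈ 𝒳 ∧ ∃ z ∈ closure s.domain, z (Fin.castAdd k 0) = V.1 ∧
        z (Fin.castAdd k 1) = V.2 := by
      rw [hV, dif_pos hex]; exact hex.choose_spec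
    obtain ⟨hVm, z', hz'cl, hz'x, hz'y⟩ := hVs
    by_contra hne
    obtain ⟨j, hj⟩ := Hb X hX V hVm hne
    rw [hdom] at hzcl hz'cl
    exact not_both_mem_closure M lo up j hj hzcl hzx hzy hz'cl hz'x hz'y
  -- the hypotheses of the far-first separation
  have hbd' : Bornology.IsBounded (gDom 1 k m' M lo up) := hdom ▸ hbd
  have hfar : ∀ j j', ((L j).1 1 ≠ 0 ∧ e j ≠ 0) → ((L j').1 1 ≠ 0 ∧ e j' ≠ 0) →
      ¬ ((lam j).1 0 * V.1 + (lam j).2 = V.2) → lam j ≠ lam j' →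
      ∃ c₀ > 0, ∀ z ∈ gDom 1 k m' M lo up, c₀ ≤ |affB 1 k (lam j - lam j') z| := by
    rintro j j' ⟨hyj, hej⟩ ⟨hyj', hej'⟩ hfarj hne
    by_cases hs : (lam j).1 0 = (lam j').1 0
    · have ht : (lam j).2 ≠ (lam j').2 := fun h => hne ((root_eq_iff _ _).2 ⟨hs, h⟩)
      refine ⟨|(((lam j).2 - (lam j').2 : ℚ) : ℝ)|, abs_pos.2 (by exact_mod_cast sub_ne_zero.2 ht),
        fun z _ => le_of_eq ?_⟩
      rw [affB_sub, affB_eq, affB_eq, hs]; push_cast; ring_nf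
    · obtain ⟨X, hX, hX', hdet, hwall⟩ := exists_cross (k := k) hyj hyj' hs
      have hXm : X ∈ 𝒳 := HX j j' X hej hej' hyj hyj' hX hX' hdet
      have hXV : X ≠ V := fun h => hfarj ((near_iff hyj V).2 (h ▸ hX))
      have hXcl : ∀ z ∈ closure (gDom 1 k m' M lo up), z (Fin.castAdd k 0) = X.1 →
          z (Fin.castAdd k 1) = X.2 → False := fun z hz hzx hzy =>
        hXV (hVuniq X hXm z (hdom ▸ hz) hzx hzy)
      obtain ⟨f, g, hf, hg, hβ, hβ'⟩ := Ha X hXm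
      obtain ⟨c₀, hc₀, hb⟩ := fst_sub_bounded_below M lo up hf hg hβ hβ' hbd' hXcl
      have hss : (0 : ℝ) < |(((lam j).1 0 - (lam j').1 0 : ℚ) : ℝ)| :=
        abs_pos.2 (by exact_mod_cast sub_ne_zero.2 hs)
      refine ⟨|(((lam j).1 0 - (lam j').1 0 : ℚ) : ℝ)| * c₀, by positivity, fun z hz => ?_⟩
      rw [hwall z, abs_mul]
      exact mul_le_mul_of_nonneg_left (hb z hz) (abs_nonneg _)
  have hnear : ∀ j j', ((L j).1 1 ≠ 0 ∧ e j ≠ 0) → ((L j').1 1 ≠ 0 ∧ e j' ≠ 0) →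
      ((lam j).1 0 * V.1 + (lam j).2 = V.2) → ((lam j').1 0 * V.1 + (lam j').2 = V.2) →
      lam j ≠ lam j' →
      (∃ C, ∀ z ∈ gDom 1 k m' M lo up, |z (Fin.castAdd k (Fin.last 1)) - affB 1 k (lam j') z| ≤
        C * |affB 1 k (lam j) z - affB 1 k (lam j') z|) ∧
      (∃ a₁ b₁ : ℚ, ∀ z ∈ gDom 1 k m' M lo up,
        (a₁ : ℝ) * (z (Fin.castAdd k 0) - V.1) < z (Fin.castAdd k 1) - V.2 ∧
        z (Fin.castAdd k 1) - V.2 < (b₁ : ℝ) * (z (Fin.castAdd k 0) - V.1)) := by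
    rintro j j' ⟨hyj, hej⟩ ⟨hyj', hej'⟩ hnj hnj' hne
    obtain ⟨hs, hwall⟩ := wall_of_near (k := k) hnj hnj' hne
    have hVm : V ∈ 𝒳 := by
      obtain ⟨X, hX, hX', hdet, -⟩ := exists_cross (k := k) hyj hyj' hs
      have h1 : evq (L j) V = 0 := (near_iff hyj V).1 hnj
      have h2 : evq (L j') V = 0 := (near_iff hyj' V).1 hnj'
      exact HX j j' V hej hej' hyj hyj' h1 h2 hdet
    obtain ⟨f, g, hf, hg, hβ, hβ'⟩ := Ha V hVm
    have hcone := cone_of_rows M lo up hf hg hβ hβ'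
    set a₁ : ℚ := -(M g).1 0 / (M g).1 1 with ha₁
    set b₁ : ℚ := -(M f).1 0 / (M f).1 1 with hb₁
    refine ⟨⟨(|(a₁ : ℝ)| + |(b₁ : ℝ)| + |((lam j').1 0 : ℝ)|) / |(((lam j).1 0 - (lam j').1 0 : ℚ) : ℝ)|,
      fun z hz => ?_⟩, a₁, b₁, hcone⟩
    obtain ⟨h1, h2⟩ := hcone z hz
    have hss : (0 : ℝ) < |(((lam j).1 0 - (lam j').1 0 : ℚ) : ℝ)| :=
      abs_pos.2 (by exact_mod_cast sub_ne_zero.2 hs)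
    rw [← affB_sub, hwall z, abs_mul, div_mul_eq_mul_div, mul_comm (|(((lam j).1 0 -
      (lam j').1 0 : ℚ) : ℝ)|), ← mul_assoc, mul_div_assoc, div_self hss.ne', mul_one]
    have hy : z (Fin.castAdd k (Fin.last 1)) - affB 1 k (lam j') z =
        (z (Fin.castAdd k 1) - V.2) - ((lam j').1 0 : ℝ) * (z (Fin.castAdd k 0) - V.1) := by
      rw [cA1, affB_eq]
      have : ((lam j').2 : ℝ) = V.2 - (lam j').1 0 * V.1 := by
        have h : (lam j').2 = V.2 - (lam j').1 0 * V.1 := by linarith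
        exact_mod_cast h
      rw [this]; ring
    rw [hy]
    have hv : |z (Fin.castAdd k 1) - V.2| ≤ (|(a₁ : ℝ)| + |(b₁ : ℝ)|) * |z (Fin.castAdd k 0) - V.1| := by
      have e1 : (b₁ : ℝ) * (z (Fin.castAdd k 0) - V.1) ≤ |(b₁ : ℝ)| * |z (Fin.castAdd k 0) - V.1| := by
        rw [← abs_mul]; exact le_abs_self _
      have e2 : -((a₁ : ℝ) * (z (Fin.castAdd k 0) - V.1)) ≤ |(a₁ : ℝ)| * |z (Fin.castAdd k 0) - V.1| := by
        rw [← abs_mul]; exact neg_le_abs _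
      rw [abs_le]; constructor <;> nlinarith [abs_nonneg (a₁ : ℝ), abs_nonneg (b₁ : ℝ),
        abs_nonneg (z (Fin.castAdd k 0) - V.1)]
    calc _ ≤ |z (Fin.castAdd k 1) - V.2| + |((lam j').1 0 : ℝ) * (z (Fin.castAdd k 0) - V.1)| :=
          abs_sub _ _
      _ ≤ (|(a₁ : ℝ)| + |(b₁ : ℝ)|) * |z (Fin.castAdd k 0) - V.1| +
          |((lam j').1 0 : ℝ)| * |z (Fin.castAdd k 0) - V.1| := by
          rw [abs_mul]; exact add_le_add hv le_rfl
      _ = _ := by ring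
  have hpole' : ∀ j, d j ≠ 0 → ∀ z ∈ s.domain,
      z (Fin.castAdd k (Fin.last 1)) - affB 1 k (lam j) z ≠ 0 := fun j hj z hz => by
    obtain ⟨hα, he⟩ := hd j hj
    have h := hpole j he z hz
    rw [affF_of_ne_zero (L j) z hα] at h
    exact right_ne_zero_of_mul h
  have hact : ∀ j, d j ≠ 0 → (L j).1 1 ≠ 0 ∧ e j ≠ 0 := hd
  have hinv0 : ∀ l, eb l ≠ 0 → (∃ c₀ > 0, ∀ z ∈ s.domain, c₀ ≤ |affB 1 k (Lb l) z|) ∨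
      (((Lb l).1 0 ≠ 0 ∧ (Lb l).1 0 * V.1 + (Lb l).2 = 0 ∧ (∃ i, d i ≠ 0) ∧
        (∀ i, d i ≠ 0 → ((lam i).1 0 * V.1 + (lam i).2 = V.2)) ∧
        (∃ a₁ b₁ : ℚ, ∀ z ∈ s.domain, (a₁ : ℝ) * (z (Fin.castAdd k 0) - V.1) <
          z (Fin.castAdd k 1) - V.2 ∧
          z (Fin.castAdd k 1) - V.2 < (b₁ : ℝ) * (z (Fin.castAdd k 0) - V.1)))) := by
    intro l hl
    have hel : eb l = if (L l).1 (Fin.last 1) = 0 then e l else 0 := rfl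
    by_cases hy : (L l).1 (Fin.last 1) = 0
    · rw [hel, if_pos hy] at hl
      obtain ⟨c₀, hc₀, hb⟩ := Hv l hl hy
      refine Or.inl ⟨c₀, hc₀, fun z hz => ?_⟩
      have := hb z hz
      have hL : Lb l = restr 1 (L l) := by
        show (if (L l).1 (Fin.last 1) = 0 then restr 1 (L l) else (0, 1)) = _; rw [if_pos hy]
      rwa [affF_of_eq_zero (L l) z hy, ← hL] at this
    · rw [hel, if_neg hy] at hl; exact absurd rfl hl
  -- separation + terminal theorem
  set T : Set KZ.FormalRep := {w | ∃ c ∈ AddSubgroup.closure (GGset 1 1 k),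
    w - c ∈ KZ.relations} with hTdef
  have hT := fun (n : ℕ) (L' : Fin n → (Fin 1 → ℚ) × ℚ) (e' : Fin n → ℕ) (d' : Fin m → ℕ)
    (s' : KZ.IntegralRep (1 + 1 + k)) (ℓ : (Fin 1 → ℚ) × ℚ) hbd'' hdom' hint' hpole'' hℓ hinv =>
    show KZ.of s' ∈ T from
      hTerm m' m M p' lam a lo up V n L' e' d' s' ℓ hbd'' hdom' hint' hpole'' hℓ hinv
  obtain ⟨c, hc, hsc⟩ := sepV_induction k m' m M p' lam a lo up V
    (fun j => (L j).1 1 ≠ 0 ∧ e j ≠ 0) T hT hfar hnear (∑ j, d j) m Lb eb d s rfl hbd hdom hshape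
    hpole' hact hinv0
  obtain ⟨c', hc', hcc⟩ := closure_transfer' (S := T) (T := GGset 1 1 k) (fun x hx => hx) c hc
  refine ⟨c', hc', ?_⟩
  have := add_mem hsc hcc
  rwa [sub_add_sub_cancel] at this

end PieceThm

end SepTwoPos

open SepTwoPos SepTwoZero SeparatePos in
/-- **Piece theorem with fibres** (registered part of `stub_separateTwoPos`; see `SepTwoPos.piece_theorem`). [Kontsevich–Zagier 2001, §1.2] -/
theorem separateTwoPos_piece (k : ℕ) (hTerm : ∀ (m' r : ℕ) (M : Fin m' → (Fin (1 + 1) → ℚ) × ℚ) (p : MvPolynomial (Fin (1 + 1)) ℚ) (lam : Fin r → (Fin 1 → ℚ) × ℚ) (a : Fin k → Option ((Fin (1 + 1) → ℚ) × ℚ)) (lo up : Fin k → Fin k ⊕ ((Fin (1 + 1) → ℚ) × ℚ)) (V : ℚ × ℚ) (m : ℕ) (L : Fin m → (Fin 1 → ℚ) × ℚ) (e : Fin m → ℕ) (d : Fin r → ℕ) (s : KZ.IntegralRep (1 + 1 + k)) (ℓ : (Fin 1 → ℚ) × ℚ), Bornology.IsBounded s.domain → s.domain = gDom 1 k m' M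 lo up → EqOn s.integrand (shape 1 k p L e lam d a) s.domain → (∀ j, d j ≠ 0 → ∀ z ∈ s.domain, z (Fin.castAdd k (Fin.last 1)) - affB 1 k (lam j) z ≠ 0) → (∀ j, d j ≠ 0 → lam j = ℓ) → (∀ j, e j ≠ 0 → (∃ c₀ > 0, ∀ z ∈ s.domain, c₀ ≤ |affB 1 k (L j) z|) ∨ ((L j).1 0 ≠ 0 ∧ (L j).1 0 * V.1 + (L j).2 = 0 ∧ (∃ i, d i ≠ 0) ∧ (∀ i, d i ≠ 0 → (lam i).1 0 * V.1 + (lam i).2 = V.2) ∧ ∃ a₁ b₁ : ℚ, ∀ z ∈ s.domain, (a₁ : ℝ) * (z (Fin.castAdd k 0) - V.1) < z (Fin.castAdd k 1) - V.2 ∧ z (Fin.castAdd k 1) - V.2 < (b₁ : ℝ) * (z (Fin.castAdd k 0) - V.1))) → ∃ c ∈ AddSubgroup.closure (GGset 1 1 k), KZ.of s - c ∈ KZ.relations) {m m' : ℕ} (s : KZ.IntegralRep (1 + 1 + k)) (M : Fin m' → (Fin (1 + 1) → ℚ) × ℚ) (L : Fin m → (Fin (1 + 1) → ℚ) × ℚ)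 (e : Fin m → ℕ) (p : MvPolynomial (Fin (1 + 1)) ℚ) (a : Fin k → Option ((Fin (1 + 1) → ℚ) × ℚ)) (lo up : Fin k → Fin k ⊕ ((Fin (1 + 1) → ℚ) × ℚ)) (hbd : Bornology.IsBounded s.domain) (hdom : s.domain = gDom 1 k m' M lo up) (hint : EqOn s.integrand (fun z => MvPolynomial.aeval (fun i => z (Fin.castAdd k i)) p / (∏ j, affF 1 k (L j) z ^ e j) * fib 1 k a z) s.domain) (𝒳 : Finset (ℚ × ℚ)) (HX : ∀ i i' (X : ℚ × ℚ), e i ≠ 0 → e i' ≠ 0 → (L i).1 1 ≠ 0 → (L i').1 1 ≠ 0 → evq (L i) X = 0 → evq (L i') X = 0 → (L i).1 0 * (L i').1 1 ≠ (L i).1 1 * (L i').1 0 → X ∈ 𝒳) (Ha : ∀ X ∈ 𝒳, ∃ j j', evq (M j) X = 0 ∧ evq (M j') X = 0 ∧ (M j).1 1 < 0 ∧ 0 < (M j').1 1) (Hb : ∀ X ∈ 𝒳, ∀ X' ∈ 𝒳, X ≠ X' → ∃ j, evq (M j) X * evq (M j) X' < 0) (hpole : ∀ i, e i ≠ 0 →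 ∀ z ∈ s.domain, affF 1 k (L i) z ≠ 0) (Hv : ∀ i, e i ≠ 0 → (L i).1 1 = 0 → ∃ c₀ > 0, ∀ z ∈ s.domain, c₀ ≤ |affF 1 k (L i) z|) : ∃ c ∈ AddSubgroup.closure (GGset 1 1 k), KZ.of s - c ∈ KZ.relations := by
  exact SepTwoPos.piece_theorem hTerm s M L e p a lo up hbd hdom hint 𝒳 HX Ha Hb hpole Hv


end Summit.KontsevichZagierPeriods.ArrangementNormalForm.JanusBands
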